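import Summits.KontsevichZagierPeriods.KontsevichZagierPeriods.Theorems.RootDecompQuadraticDescentDarkPairsEleven
import Literature.NumberTheory.Transcendental.KZCubeRationalMoves
import HarnessLib
import Literature.NumberTheory.Transcendental.SemialgebraicVolume
import Summits.KontsevichZagierPeriods.KontsevichZagierPeriods.Theorems.RootDecompQuadraticDescentPair18HomotopyAngP20
import Summits.KontsevichZagierPeriods.KontsevichZagierPeriods.Theorems.RootDecompQuadraticDescentPair18HomotopyEulerP2

/-! # `RootDecompQuadraticDescentPair18HomotopyGridP1` — part 1/5 of the mechanical ≤400-line split of `Grid_landing.lean` (sha256 c1ef4f0ae5c58233…)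
Source: decomp-kz lens-6 g10 `Pair18HomotopyGrid.lean` (file #4; HOME/decomp-kz-lens-6/g10/, sha256 f97d8f44…; critic g5-19 CLEARED «census pair #18 = THEOREM, no hypothesis left»): hGrid_of_charts (hTh7) (hB17) : 4•[B11] − [Th7] − [B17] − 2•[PB7] ∈ KZ.relations — the nine-cell W₇-chart scissors congruence (7 cuts, 4 swaps, 4 inversions x ↦ 1/(7x) via W7_invert, linear cov); landed by census-1 g9 over the landed files #1/#2/#3 (copied prelude dropped, homonyms suffixed G, pins removed).
Split by census-1 g9 `gen/splitlean.py`: scopes re-opened with their `open`/`variable`/`set_option` context; mathematics and declaration order unchanged. -/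

/-!
# Pair18HomotopyGrid — companion file #4 of `Pair18Homotopy.lean` (decomp-kz-lens-6, gen 10)

Companion file #4 to `Pair18Homotopy.lean` (file #1, v14) and `Pair18HomotopyAng.lean` (file #2, v13):
it discharges the hypothesis `hGrid` of `pair18_g8strips_of_grid` (file #1, l.8615) from the two chart
identifications proved in file #2,

  `hGrid_of_charts (hTh7 : [Th7] ≡ [W₇|□]) (hB17 : [B17] ≡ [W₇|[0,1/7]²]) :
     4 • KZ.of B11.rep - KZ.of Th7.rep - KZ.of B17.rep - 2 • KZ.of PB7.rep ∈ KZ.relations`,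

so that, together with file #3 (`Pair18HomotopyEuler.lean`, `hEuler_holds`) and file #2 (`hTh7_holds`,
`hB17_holds`, `hAng4_holds`), census pair #18 closes unconditionally:

  `pair18_g8strips_of_grid hEuler_holds (hGrid_of_charts hTh7_holds hB17_holds) hAng4_holds`.

MATHEMATICS (§21).  In the `W₇ = 7/((1+7x²)(1+7y²))` chart the substitution `x = tan φ/√7` turns
`[W₇ | I×I']` into the product of `φ`-lengths; with `θ = arctan √7`, `θ₁ = π/2 - θ = arctan(1/√7)` the
break points `0, 1/7, 1/√7, 1` have `φ = 0, θ₁, π/4, θ`, so `J₁=[0,1/7], J₂=[1/7,1/√7], J₃=[1/√7,1]` have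
`φ`-lengths `θ₁, π/4-θ₁, π/4-θ₁`.  The equality of the last two is realised by the involution
`x ↦ 1/(7x)` (`W7_invert`: it maps `J₃` onto `J₂` and `W₇(1/(7x),y)/(7x²) = W₇(x,y)`), the symmetry in
`x, y` by the swap (`W7_swap`, file #2).  Cutting `□` along `7x²=1, 7y²=1, 7x=1, 7y=1` (seven `rel_cut`s)
and using four swaps and four inversions gives the scissors congruence
`4·[W₇|A²] - [W₇|□] - [W₇|J₁²] - 2·[W₇|J₁×[0,1]] ≡ 0` (`A = J₁∪J₂`), i.e. `4(π/4)² = θ² + θ₁² + 2θθ₁`.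
The remaining identifications: `[PB7] ≡ [W₇|J₁×[0,1]]` by the linear substitution `x ↦ x/7` (`PB7_C1`),
and `[B11] ≡ [W₇|A²]` (`B11_Bsq`) by the `U = 1` copy of file #2's §19u chain
(`Bq_Bbox 1`, null edge, fibre cov `(v,b) ↦ (v,vb)` onto `[W₂|TriG]`, `W₂ = 2/((1+x²)(1+y²))`) followed by
the scaling `z ↦ z/√7` (`W2Tri_Sc`, ℚ-semialgebraic via `isSemialgebraicFunOn_add_div_sqrt`), which carries
`[W₂|TriG]` to `[2W₇|A² ∩ {y≤x}]`, and the diagonal cut + swap.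

LAYOUT.  `-- COPIED PRELUDE` = verbatim declarations of files #1/#2 (same namespace
`…RootDecompQuadraticDescent.Pair18Homotopy`, line ranges marked `[P1 l.…]`/`[P2 l.…]`); at landing the
prelude is dropped and §21 (namespace `Grid` + `hGrid_of_charts`) is spliced after file #2's §19/§20.
New declarations: `Grid.sXX7 … Grid.W7TriUpB` (sets/reps), `Grid.sq_of_lin … Grid.Sw_cube` (real facts),
`Grid.volume_xx_one/yy_one`, cuts `Grid.cutA cutKA cutK3 cutC1 cutJ2 cutB cutJ1`, swaps
`Grid.swAJ3 swJ23 swJ13 swC21`, `Grid.Iv`, `Grid.W7_invert`, `Grid.ivJ3A ivJ33 ivJ32 ivJ31`, `Grid.Sc7`,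
`Grid.PB7_C1`, `Grid.W14` (verbatim P2 l.4683) `Grid.W1Den Grid.W2 Grid.Bq1P Grid.W2Tri Grid.W2TriP Grid.W14TriB`,
`Grid.Bq1_P Grid.W2Tri_P Grid.Bq1P_cov Grid.Scl Grid.Tcl Grid.W2Tri_Sc Grid.W14TriB_twice Grid.Bsq_diag
Grid.TriUpB_TriB Grid.B11_Bsq`, and `hGrid_of_charts` (+ `#print axioms` guard: propext, Classical.choice,
Quot.sound).  Complete proofs, no `instance`/`notation`; farm `lean check --no-snap` rc 0, no warnings.
-/

set_option linter.unusedSimpArgs false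

noncomputable section

open _root_.Set MvPolynomial

namespace Summit.KontsevichZagierPeriods.RootDecompQuadraticDescent.Pair18Homotopy

open Literature.NumberTheory.Transcendental
open Literature.NumberTheory.Transcendental.KZ (RFun cube)
open Summit.KontsevichZagierPeriods.RootDecompQuadraticDescent.DarkPairs (rel_reflect_rep rel_double)

-- landed-private prelude lemmas re-declared for this module (gate dedup twins of tree lemmas; privatised again at landing):
/-- Auxiliary step `cube2` (§0): cube2. [bookkeeping] -/
private theorem cube2 {x : Fin 2 → ℝ} (hx : x ∈ KZ.cube 2) : (0 ≤ x 0 ∧ x 0 ≤ 1) ∧ (0 ≤ x 1 ∧ x 1 ≤ 1) := ⟨hx 0, hx 1⟩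

/-- Auxiliary step `vec2_0` (§2b): vec2 0. [bookkeeping] -/
private theorem vec2_0 (a b : ℝ) : (![a, b] : Fin 2 → ℝ) 0 = a := rfl

/-- Auxiliary step `vec2_1` (§2b): vec2 1. [bookkeeping] -/
private theorem vec2_1 (a b : ℝ) : (![a, b] : Fin 2 → ℝ) 1 = b := rfl

/-- Auxiliary step `h7q` (§19u): h7q. [bookkeeping] -/
private theorem h7q : (0:ℚ) ≤ 7 := by norm_num

/-- Auxiliary step `volume_edge0` (§19u): volume edge0. [bookkeeping] -/
private theorem volume_edge0 : MeasureTheory.volume {z : Fin 2 → ℝ | z 0 = 0} = 0 := by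
  have h := volume_setOf_aeval_eq_zero (k := ℚ) (m := 2) (X 0 : MvPolynomial (Fin 2) ℚ) (by
    rw [MvPolynomial.map_X]; exact MvPolynomial.X_ne_zero 0)
  have e : {x : Fin 2 → ℝ | aeval x (X 0 : MvPolynomial (Fin 2) ℚ) = 0} = {z | z 0 = 0} := by
    ext z; simp only [mem_setOf_eq, aeval_X]
  rw [e] at h; exact h

-- ===== COPIED PRELUDE (verbatim from Pair18Homotopy.lean v14 [P1] / Pair18HomotopyAng.lean v13 [P2]; not to be spliced) =====
-- [P1 l.163, 1322–1323]

section Fold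
open Literature.ModelTheory.ExponentialFields (IsSemialgebraic isSemialgebraic_setOf_eval_le
  isSemialgebraic_setOf_eval_pos isSemialgebraic_setOf_eval_nonneg isSemialgebraic_setOf_eval_eq_zero)

-- [P2 l.88–92]

-- [P2 l.130–149]

-- [P2 l.173–194]
-- (verbatim from Pair18Homotopy.lean v14: Th7 l.3279–3287, Bbox l.4753–4762, B17 l.5042–5043)

-- [P1 l.1244–1320]

-- [P2 l.4542–4607]

-- [P2 l.3179–3224]

-- [P2 l.3226–3252]

-- [P2 l.3381–3392]

-- [P2 l.3897–3961]

-- [P2 l.3500, 3502, 3505–3507, 3511–3516, 3976–3978]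

-- [P2 l.4136–4137, 4146–4147, 4165–4168]

-- [P2 l.4178–4205]

-- [P2 l.4210–4214]

-- [P2 l.4609–4680]

/-- Auxiliary step `Th7_eqG`: Th7 eq G. [bookkeeping] -/
private theorem Th7_eqG : Th7.rep = (Bbox 7 h7q).rep := rfl

-- [P2 l.4684–4705]
/-- Auxiliary definition `TriG`: Tri G. [bookkeeping] -/
def TriG : Set (Fin 2 → ℝ) := cube 2 ∩ sDiag
/-- Auxiliary definition `TriPG`: Tri PG. [bookkeeping] -/
def TriPG : Set (Fin 2 → ℝ) := TriG ∩ sPos0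
/-- Auxiliary step `isSemialgebraic_TriG`: is Semialgebraic Tri G. [bookkeeping] -/
theorem isSemialgebraic_TriG : IsSemialgebraic ℚ TriG := KZ.isSemialgebraic_cube.inter isSemialgebraic_sDiag
/-- Auxiliary step `isSemialgebraic_TriPG`: is Semialgebraic Tri PG. [bookkeeping] -/
theorem isSemialgebraic_TriPG : IsSemialgebraic ℚ TriPG := isSemialgebraic_TriG.inter isSemialgebraic_sPos0

-- [P2 l.4712–4725]
/-- Auxiliary step `volume_diagG`: volume diag G. [bookkeeping] -/
private theorem volume_diagG : MeasureTheory.volume {z : Fin 2 → ℝ | z 1 - z 0 = 0} = 0 := by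
  have h := volume_setOf_aeval_eq_zero (k := ℚ) (m := 2) (X 1 - X 0 : MvPolynomial (Fin 2) ℚ) (by
    intro h0
    have h1 := congr_arg (MvPolynomial.eval ![(0:ℝ), 1]) h0
    simp at h1)
  have e : {x : Fin 2 → ℝ | aeval x (X 1 - X 0 : MvPolynomial (Fin 2) ℚ) = 0} = {z | z 1 - z 0 = 0} := by
    ext z; simp only [mem_setOf_eq, map_sub, aeval_X]
  rw [e] at h; exact h

-- [P2 l.4747–4750]

-- [P1 l.5534–5542]

-- [P1 l.8603–8604]
-- ===== END OF COPIED PRELUDE =====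

/-! ## §21 (g10) hGrid — the angle-grid scissors congruence in the `W₇` chart

With `θ = arctan √7` and the substitution `x = tan(φ)/√7`, `[W₇ | [a,b]×[c,d]] = (φ(b)-φ(a))(φ(d)-φ(c))`,
`φ(0)=0, φ(1/7)=θ₁:=arctan(1/√7)=π/2-θ, φ(1/√7)=π/4, φ(1)=θ`.  Hence with
`J₁=[0,1/7], J₂=[1/7,1/√7], J₃=[1/√7,1]` the three `φ`-lengths are `θ₁, π/4-θ₁, π/4-θ₁`
(`x ↦ 1/(7x)` swaps `J₂` and `J₃` and preserves `W₇ dx`), and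
`4·[W₇|(J₁∪J₂)²] - [W₇|□] - [W₇|J₁²] - 2·[W₇|J₁×[0,1]] = 4(π/4)² - θ² - θ₁² - 2θ₁θ = 0`.
Inputs: `[B11] ≡ [W₇|(J₁∪J₂)²]` (the `U = 1` copy of §19u: `(π/4)²`), `[PB7] ≡ [W₇|J₁×[0,1]]`
(the linear substitution `x ↦ x/7`), and the two chart identifications `hTh7`, `hB17` of file #2,
taken here as hypotheses. -/

namespace Grid

/-! ### sets -/
/-- Auxiliary definition `sXX7` (§21): s XX7. [bookkeeping] -/
def sXX7 : Set (Fin 2 → ℝ) := {z | 7 * (z 0 * z 0) ≤ 1}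
/-- Auxiliary definition `sXX7c` (§21): s XX7c. [bookkeeping] -/
def sXX7c : Set (Fin 2 → ℝ) := {z | 1 ≤ 7 * (z 0 * z 0)}
/-- Auxiliary definition `sYY7` (§21): s YY7. [bookkeeping] -/
def sYY7 : Set (Fin 2 → ℝ) := {z | 7 * (z 1 * z 1) ≤ 1}
/-- Auxiliary definition `sYY7c` (§21): s YY7c. [bookkeeping] -/
def sYY7c : Set (Fin 2 → ℝ) := {z | 1 ≤ 7 * (z 1 * z 1)}
/-- Auxiliary step `isSemialgebraic_sXX7` (§21): is Semialgebraic s XX7. [bookkeeping] -/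
theorem isSemialgebraic_sXX7 : IsSemialgebraic ℚ sXX7 :=
  isSemialgebraic_of_le (C 7 * (X 0 * X 0)) (C 1) sXX7 fun z => by
    simp only [sXX7, mem_setOf_eq, map_mul, aeval_C, aeval_X, eq_ratCast, Rat.cast_ofNat, Rat.cast_one]
/-- Auxiliary step `isSemialgebraic_sXX7c` (§21): is Semialgebraic s XX7c. [bookkeeping] -/
theorem isSemialgebraic_sXX7c : IsSemialgebraic ℚ sXX7c :=
  isSemialgebraic_of_le (C 1) (C 7 * (X 0 * X 0)) sXX7c fun z => by
    simp only [sXX7c, mem_setOf_eq, map_mul, aeval_C, aeval_X, eq_ratCast, Rat.cast_ofNat, Rat.cast_one]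
/-- Auxiliary step `isSemialgebraic_sYY7` (§21): is Semialgebraic s YY7. [bookkeeping] -/
theorem isSemialgebraic_sYY7 : IsSemialgebraic ℚ sYY7 :=
  isSemialgebraic_of_le (C 7 * (X 1 * X 1)) (C 1) sYY7 fun z => by
    simp only [sYY7, mem_setOf_eq, map_mul, aeval_C, aeval_X, eq_ratCast, Rat.cast_ofNat, Rat.cast_one]
/-- Auxiliary step `isSemialgebraic_sYY7c` (§21): is Semialgebraic s YY7c. [bookkeeping] -/
theorem isSemialgebraic_sYY7c : IsSemialgebraic ℚ sYY7c :=
  isSemialgebraic_of_le (C 1) (C 7 * (X 1 * X 1)) sYY7c fun z => by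
    simp only [sYY7c, mem_setOf_eq, map_mul, aeval_C, aeval_X, eq_ratCast, Rat.cast_ofNat, Rat.cast_one]

/-- `A := J₁ ∪ J₂ = {7x² ≤ 1}`, `J₃ = {1 ≤ 7x²}`, `J₁ = {7x ≤ 1}`, `J₂ = A ∩ {1 ≤ 7x}`. -/
def KA : Set (Fin 2 → ℝ) := cube 2 ∩ sXX7          -- A × [0,1]
/-- Auxiliary definition `K3` (§21): K3. [bookkeeping] -/
def K3 : Set (Fin 2 → ℝ) := cube 2 ∩ sXX7c         -- J₃ × [0,1]
/-- Auxiliary definition `Bsq` (§21): Bsq. [bookkeeping] -/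
def Bsq : Set (Fin 2 → ℝ) := KA ∩ sYY7             -- A × A
/-- Auxiliary definition `AJ3` (§21): AJ3. [bookkeeping] -/
def AJ3 : Set (Fin 2 → ℝ) := KA ∩ sYY7c            -- A × J₃
/-- Auxiliary definition `J3A` (§21): J3 A. [bookkeeping] -/
def J3A : Set (Fin 2 → ℝ) := K3 ∩ sYY7             -- J₃ × A
/-- Auxiliary definition `J33` (§21): J33. [bookkeeping] -/
def J33 : Set (Fin 2 → ℝ) := K3 ∩ sYY7c            -- J₃ × J₃
/-- Auxiliary definition `J1A` (§21): J1 A. [bookkeeping] -/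
def J1A : Set (Fin 2 → ℝ) := C1 ∩ sYY7             -- J₁ × A
/-- Auxiliary definition `J13` (§21): J13. [bookkeeping] -/
def J13 : Set (Fin 2 → ℝ) := C1 ∩ sYY7c            -- J₁ × J₃
/-- Auxiliary definition `J2A` (§21): J2 A. [bookkeeping] -/
def J2A : Set (Fin 2 → ℝ) := Bsq ∩ sX7c            -- J₂ × A
/-- Auxiliary definition `C12` (§21): C12. [bookkeeping] -/
def C12 : Set (Fin 2 → ℝ) := J1A ∩ sY7c            -- J₁ × J₂
/-- Auxiliary definition `C21` (§21): C21. [bookkeeping] -/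
def C21 : Set (Fin 2 → ℝ) := J2A ∩ sY7             -- J₂ × J₁
/-- Auxiliary definition `C22` (§21): C22. [bookkeeping] -/
def C22 : Set (Fin 2 → ℝ) := J2A ∩ sY7c            -- J₂ × J₂
/-- Auxiliary definition `J23` (§21): J23. [bookkeeping] -/
def J23 : Set (Fin 2 → ℝ) := AJ3 ∩ sX7c            -- J₂ × J₃
/-- Auxiliary definition `J32` (§21): J32. [bookkeeping] -/
def J32 : Set (Fin 2 → ℝ) := J3A ∩ sY7c            -- J₃ × J₂
/-- Auxiliary definition `J31` (§21): J31. [bookkeeping] -/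
def J31 : Set (Fin 2 → ℝ) := K3 ∩ sY7              -- J₃ × J₁
/-- Auxiliary definition `TriB` (§21): Tri B. [bookkeeping] -/
def TriB : Set (Fin 2 → ℝ) := Bsq ∩ sDiag
/-- Auxiliary definition `TriUpB` (§21): Tri Up B. [bookkeeping] -/
def TriUpB : Set (Fin 2 → ℝ) := Bsq ∩ sDiagU
/-- Auxiliary step `isSemialgebraic_KA` (§21): is Semialgebraic KA. [bookkeeping] -/
theorem isSemialgebraic_KA : IsSemialgebraic ℚ KA := KZ.isSemialgebraic_cube.inter isSemialgebraic_sXX7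
/-- Auxiliary step `isSemialgebraic_K3` (§21): is Semialgebraic K3. [bookkeeping] -/
theorem isSemialgebraic_K3 : IsSemialgebraic ℚ K3 := KZ.isSemialgebraic_cube.inter isSemialgebraic_sXX7c
/-- Auxiliary step `isSemialgebraic_Bsq` (§21): is Semialgebraic Bsq. [bookkeeping] -/
theorem isSemialgebraic_Bsq : IsSemialgebraic ℚ Bsq := isSemialgebraic_KA.inter isSemialgebraic_sYY7
/-- Auxiliary step `isSemialgebraic_AJ3` (§21): is Semialgebraic AJ3. [bookkeeping] -/
theorem isSemialgebraic_AJ3 : IsSemialgebraic ℚ AJ3 := isSemialgebraic_KA.inter isSemialgebraic_sYY7c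
/-- Auxiliary step `isSemialgebraic_J3A` (§21): is Semialgebraic J3 A. [bookkeeping] -/
theorem isSemialgebraic_J3A : IsSemialgebraic ℚ J3A := isSemialgebraic_K3.inter isSemialgebraic_sYY7
/-- Auxiliary step `isSemialgebraic_J33` (§21): is Semialgebraic J33. [bookkeeping] -/
theorem isSemialgebraic_J33 : IsSemialgebraic ℚ J33 := isSemialgebraic_K3.inter isSemialgebraic_sYY7c
/-- Auxiliary step `isSemialgebraic_J1A` (§21): is Semialgebraic J1 A. [bookkeeping] -/
theorem isSemialgebraic_J1A : IsSemialgebraic ℚ J1A := isSemialgebraic_C1.inter isSemialgebraic_sYY7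
/-- Auxiliary step `isSemialgebraic_J13` (§21): is Semialgebraic J13. [bookkeeping] -/
theorem isSemialgebraic_J13 : IsSemialgebraic ℚ J13 := isSemialgebraic_C1.inter isSemialgebraic_sYY7c
/-- Auxiliary step `isSemialgebraic_J2A` (§21): is Semialgebraic J2 A. [bookkeeping] -/
theorem isSemialgebraic_J2A : IsSemialgebraic ℚ J2A := isSemialgebraic_Bsq.inter isSemialgebraic_sX7c
/-- Auxiliary step `isSemialgebraic_C12` (§21): is Semialgebraic C12. [bookkeeping] -/
theorem isSemialgebraic_C12 : IsSemialgebraic ℚ C12 := isSemialgebraic_J1A.inter isSemialgebraic_sY7c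
/-- Auxiliary step `isSemialgebraic_C21` (§21): is Semialgebraic C21. [bookkeeping] -/
theorem isSemialgebraic_C21 : IsSemialgebraic ℚ C21 := isSemialgebraic_J2A.inter isSemialgebraic_sY7
/-- Auxiliary step `isSemialgebraic_C22` (§21): is Semialgebraic C22. [bookkeeping] -/
theorem isSemialgebraic_C22 : IsSemialgebraic ℚ C22 := isSemialgebraic_J2A.inter isSemialgebraic_sY7c
/-- Auxiliary step `isSemialgebraic_J23` (§21): is Semialgebraic J23. [bookkeeping] -/
theorem isSemialgebraic_J23 : IsSemialgebraic ℚ J23 := isSemialgebraic_AJ3.inter isSemialgebraic_sX7c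
/-- Auxiliary step `isSemialgebraic_J32` (§21): is Semialgebraic J32. [bookkeeping] -/
theorem isSemialgebraic_J32 : IsSemialgebraic ℚ J32 := isSemialgebraic_J3A.inter isSemialgebraic_sY7c
/-- Auxiliary step `isSemialgebraic_J31` (§21): is Semialgebraic J31. [bookkeeping] -/
theorem isSemialgebraic_J31 : IsSemialgebraic ℚ J31 := isSemialgebraic_K3.inter isSemialgebraic_sY7
/-- Auxiliary step `isSemialgebraic_TriB` (§21): is Semialgebraic Tri B. [bookkeeping] -/
theorem isSemialgebraic_TriB : IsSemialgebraic ℚ TriB := isSemialgebraic_Bsq.inter isSemialgebraic_sDiag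
/-- Auxiliary step `isSemialgebraic_TriUpB` (§21): is Semialgebraic Tri Up B. [bookkeeping] -/
theorem isSemialgebraic_TriUpB : IsSemialgebraic ℚ TriUpB := isSemialgebraic_Bsq.inter isSemialgebraic_sDiagU
/-- Auxiliary definition `W7KA` (§21): W7 KA. [bookkeeping] -/
def W7KA : KZ.IntegralRep 2 := W7.rep.restrict KA isSemialgebraic_KA (fun _ hz => hz.1)
/-- Auxiliary definition `W7K3` (§21): W7 K3. [bookkeeping] -/
def W7K3 : KZ.IntegralRep 2 := W7.rep.restrict K3 isSemialgebraic_K3 (fun _ hz => hz.1)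
/-- Auxiliary definition `W7Bsq` (§21): W7 Bsq. [bookkeeping] -/
def W7Bsq : KZ.IntegralRep 2 := W7.rep.restrict Bsq isSemialgebraic_Bsq (fun _ hz => hz.1.1)
/-- Auxiliary definition `W7AJ3` (§21): W7 AJ3. [bookkeeping] -/
def W7AJ3 : KZ.IntegralRep 2 := W7.rep.restrict AJ3 isSemialgebraic_AJ3 (fun _ hz => hz.1.1)
/-- Auxiliary definition `W7J3A` (§21): W7 J3 A. [bookkeeping] -/
def W7J3A : KZ.IntegralRep 2 := W7.rep.restrict J3A isSemialgebraic_J3A (fun _ hz => hz.1.1)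
/-- Auxiliary definition `W7J33` (§21): W7 J33. [bookkeeping] -/
def W7J33 : KZ.IntegralRep 2 := W7.rep.restrict J33 isSemialgebraic_J33 (fun _ hz => hz.1.1)
/-- Auxiliary definition `W7J1A` (§21): W7 J1 A. [bookkeeping] -/
def W7J1A : KZ.IntegralRep 2 := W7.rep.restrict J1A isSemialgebraic_J1A (fun _ hz => hz.1.1)
/-- Auxiliary definition `W7J13` (§21): W7 J13. [bookkeeping] -/
def W7J13 : KZ.IntegralRep 2 := W7.rep.restrict J13 isSemialgebraic_J13 (fun _ hz => hz.1.1)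
/-- Auxiliary definition `W7J2A` (§21): W7 J2 A. [bookkeeping] -/
def W7J2A : KZ.IntegralRep 2 := W7.rep.restrict J2A isSemialgebraic_J2A (fun _ hz => hz.1.1.1)
/-- Auxiliary definition `W7C12` (§21): W7 C12. [bookkeeping] -/
def W7C12 : KZ.IntegralRep 2 := W7.rep.restrict C12 isSemialgebraic_C12 (fun _ hz => hz.1.1.1)
/-- Auxiliary definition `W7C21` (§21): W7 C21. [bookkeeping] -/
def W7C21 : KZ.IntegralRep 2 := W7.rep.restrict C21 isSemialgebraic_C21 (fun _ hz => hz.1.1.1.1)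
/-- Auxiliary definition `W7C22` (§21): W7 C22. [bookkeeping] -/
def W7C22 : KZ.IntegralRep 2 := W7.rep.restrict C22 isSemialgebraic_C22 (fun _ hz => hz.1.1.1.1)
/-- Auxiliary definition `W7J23` (§21): W7 J23. [bookkeeping] -/
def W7J23 : KZ.IntegralRep 2 := W7.rep.restrict J23 isSemialgebraic_J23 (fun _ hz => hz.1.1.1)
/-- Auxiliary definition `W7J32` (§21): W7 J32. [bookkeeping] -/
def W7J32 : KZ.IntegralRep 2 := W7.rep.restrict J32 isSemialgebraic_J32 (fun _ hz => hz.1.1.1)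
/-- Auxiliary definition `W7J31` (§21): W7 J31. [bookkeeping] -/
def W7J31 : KZ.IntegralRep 2 := W7.rep.restrict J31 isSemialgebraic_J31 (fun _ hz => hz.1.1)
/-- Auxiliary definition `W7TriB` (§21): W7 Tri B. [bookkeeping] -/
def W7TriB : KZ.IntegralRep 2 := W7.rep.restrict TriB isSemialgebraic_TriB (fun _ hz => hz.1.1.1)
/-- Auxiliary definition `W7TriUpB` (§21): W7 Tri Up B. [bookkeeping] -/
def W7TriUpB : KZ.IntegralRep 2 := W7.rep.restrict TriUpB isSemialgebraic_TriUpB (fun _ hz => hz.1.1.1)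

/-! ### elementary real facts -/
/-- `7t ≤ 1, 0 ≤ t ⇒ 7t² ≤ 1` (`J₁ ⊆ A`). -/
theorem sq_of_lin {t : ℝ} (h0 : 0 ≤ t) (h : 7 * t ≤ 1) : 7 * (t * t) ≤ 1 := by
  nlinarith [mul_le_mul_of_nonneg_right h h0]
/-- Auxiliary step `pos_of_sq` (§21): pos of sq. [bookkeeping] -/
theorem pos_of_sq {t : ℝ} (h0 : 0 ≤ t) (h : 1 ≤ 7 * (t * t)) : 0 < t := by nlinarith
/-- Auxiliary step `lin_of_sq` (§21): lin of sq. [bookkeeping] -/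
theorem lin_of_sq {t : ℝ} (h0 : 0 ≤ t) (h1 : t ≤ 1) (h : 1 ≤ 7 * (t * t)) : 1 ≤ 7 * t := by
  nlinarith [mul_le_mul_of_nonneg_left h1 h0]
/-- Auxiliary step `iv_pos` (§21): iv pos. [bookkeeping] -/
theorem iv_pos {t : ℝ} (ht : 0 < t) : 0 < 1 / (7 * t) := by positivity
/-- Auxiliary step `iv_mul` (§21): iv mul. [bookkeeping] -/
theorem iv_mul {t : ℝ} (ht : 0 < t) : 7 * (1 / (7 * t)) * t = 1 := by
  field_simp
/-- Auxiliary step `iv_sq` (§21): iv sq. [bookkeeping] -/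
theorem iv_sq {t u : ℝ} (hu : 7 * u * t = 1) : 49 * (u * u) * (t * t) = 1 := by
  linear_combination (7 * u * t + 1) * hu
/-- with `u = 1/(7t)`: `t ≤ 1 ⇒ 1 ≤ 7u`, `1 ≤ 7t ⇒ u ≤ 1`, `1 ≤ 7t² ⇒ 7u² ≤ 1`, `7t² ≤ 1 ⇒ 1 ≤ 7u²`. -/
theorem iv_F1 {t u : ℝ} (hu0 : 0 < u) (hu : 7 * u * t = 1) (h : t ≤ 1) : 1 ≤ 7 * u := by
  nlinarith [mul_nonneg hu0.le (sub_nonneg.2 h)]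
/-- Auxiliary step `iv_F4` (§21): iv F4. [bookkeeping] -/
theorem iv_F4 {t u : ℝ} (hu0 : 0 < u) (hu : 7 * u * t = 1) (h : 1 ≤ 7 * t) : u ≤ 1 := by
  nlinarith [mul_nonneg hu0.le (sub_nonneg.2 h)]
/-- Auxiliary step `iv_F2` (§21): iv F2. [bookkeeping] -/
theorem iv_F2 {t u : ℝ} (hu : 7 * u * t = 1) (h : 1 ≤ 7 * (t * t)) : 7 * (u * u) ≤ 1 := by
  nlinarith [mul_nonneg (mul_self_nonneg u) (sub_nonneg.2 h), iv_sq hu]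
/-- Auxiliary step `iv_F3` (§21): iv F3. [bookkeeping] -/
theorem iv_F3 {t u : ℝ} (hu : 7 * u * t = 1) (h : 7 * (t * t) ≤ 1) : 1 ≤ 7 * (u * u) := by
  nlinarith [mul_nonneg (mul_self_nonneg u) (sub_nonneg.2 h), iv_sq hu]
/-- Auxiliary step `c7_le_one` (§21): c7 le one. [bookkeeping] -/
theorem c7_le_one : c7 ≤ 1 := by nlinarith [c7_mul_self, c7_pos]
/-- Auxiliary step `c7_sq` (§21): c7 sq. [bookkeeping] -/
theorem c7_sq (t : ℝ) : 7 * (c7 * t * (c7 * t)) = t * t := by linear_combination (t * t) * c7_mul_self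
/-- Auxiliary step `Sw_cube` (§21): Sw cube. [bookkeeping] -/
theorem Sw_cube {z : Fin 2 → ℝ} (hz : z ∈ cube 2) : Sw z ∈ cube 2 := by
  intro i
  fin_cases i
  · exact (cube2 hz).2
  · exact (cube2 hz).1

/-! ### null lines -/
/-- Auxiliary step `volume_xx_one` (§21): volume xx one. [bookkeeping] -/
theorem volume_xx_one : MeasureTheory.volume {z : Fin 2 → ℝ | 7 * (z 0 * z 0) = 1} = 0 := by
  have h := volume_setOf_aeval_eq_zero (k := ℚ) (m := 2) (C 7 * (X 0 * X 0) - C 1 : MvPolynomial (Fin 2) ℚ) (by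
    intro h0
    have h1 := congr_arg (MvPolynomial.eval (fun _ => (0:ℝ))) h0
    simp at h1)
  have e : {x : Fin 2 → ℝ | aeval x (C 7 * (X 0 * X 0) - C 1 : MvPolynomial (Fin 2) ℚ) = 0} =
      {z : Fin 2 → ℝ | 7 * (z 0 * z 0) = 1} := by
    ext z
    simp only [mem_setOf_eq, map_sub, map_mul, aeval_C, aeval_X, eq_ratCast, Rat.cast_ofNat, Rat.cast_one,
      sub_eq_zero]
  rw [← e]; exact h
/-- Auxiliary step `volume_yy_one` (§21): volume yy one. [bookkeeping] -/
theorem volume_yy_one : MeasureTheory.volume {z : Fin 2 → ℝ | 7 * (z 1 * z 1) = 1} = 0 := by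
  have h := volume_setOf_aeval_eq_zero (k := ℚ) (m := 2) (C 7 * (X 1 * X 1) - C 1 : MvPolynomial (Fin 2) ℚ) (by
    intro h0
    have h1 := congr_arg (MvPolynomial.eval (fun _ => (0:ℝ))) h0
    simp at h1)
  have e : {x : Fin 2 → ℝ | aeval x (C 7 * (X 1 * X 1) - C 1 : MvPolynomial (Fin 2) ℚ) = 0} =
      {z : Fin 2 → ℝ | 7 * (z 1 * z 1) = 1} := by
    ext z
    simp only [mem_setOf_eq, map_sub, map_mul, aeval_C, aeval_X, eq_ratCast, Rat.cast_ofNat, Rat.cast_one,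
      sub_eq_zero]
  rw [← e]; exact h

end Grid
end Fold
end Summit.KontsevichZagierPeriods.RootDecompQuadraticDescent.Pair18Homotopy
end
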